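import Mathlib.MeasureTheory.Function.LpSeminorm.Basic
import Mathlib.MeasureTheory.Function.LpSpace.Basic
import Mathlib.Topology.MetricSpace.HolderNorm
import Mathlib.Analysis.Normed.Group.AddCircle
import Literature.Analysis.FunctionSpaces.FlatTorus
import Literature.Analysis.FunctionSpaces.HolderNorm
import HarnessLib

-- provenance: harness21/H21/H21/Prelude/Sobolev/BesovDifference.lean @ f7a6f2c (interim HEAD d8f2665); M5 mechanical rewrite
/-!
# Nikol'skii–Besov classes `B^s_{p,∞}` and `B^s_{p,c₀}` via difference quotients
(trunk: Sobolev, concept C10 / notion `besov_difference_quotient`)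

For `0 < s < 1` the Nikol'skii–Besov space `B^s_{p,∞}` is the space of `f ∈ L^p` with
`sup_{h ≠ 0} ‖f(· + h) - f‖_{L^p} / |h|^s < ∞` (Triebel 1983, §2.5.12; Constantin–E–Titi 1994;
Cheskidov–Constantin–Friedlander–Shvydkoy 2008, §2). The closed subspace `B^s_{p,c₀}` of
Cheskidov–Constantin–Friedlander–Shvydkoy (2008) / Cheskidov–Luo (2021) consists of those `f` for
which the difference quotient moreover tends to `0` as `h → 0`.

Mathlib has no Besov spaces (searched: `Besov`, `Nikol`); the anchors used are `eLpNorm`, `MemLp`,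
`Filter.Tendsto`, `nhdsWithin`. We provide

* `eBesovSupSeminorm s p f μ = ⨆ (h ≠ 0), ‖f(· + h) - f‖_{L^p(μ)} / ‖h‖^s` and the norm
  `eBesovSupNorm = ‖f‖_{L^p} + eBesovSupSeminorm`;
* the classes `MemBesovSup s p f μ` (`f ∈ B^s_{p,∞}`) and `MemBesovSupVanishing s p f μ`
  (`f ∈ B^s_{p,c₀}`), kept apart on purpose (Onsager rigidity uses both: CET 1994 vs CCFS 2008);
* the time-dependent classes `L^q_t B^s_{p,∞}` (`eLpBesovSupNorm`, `MemLpBesovSup`) and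
  `L^q_t B^s_{p,c₀}` (`MemLpBesovSupVanishing`) for `u : ℝ → G → F` on a time set `S`;
* API: `memBesovSup_zero` (proved); exponent lowering on a *bounded* group, proved:
  `MemBesovSup.mono_exponent'` (`B^s_{p,∞} ⊂ B^{s'}_{p,∞}`, `s' ≤ s`) and
  `MemBesovSup.memBesovSupVanishing_of_lt'` (`B^s_{p,∞} ⊂ B^{s'}_{p,c₀}`, `s' < s`), with the
  time-dependent forms `MemLpBesovSup.mono_exponent`, `MemLpBesovSup.memLpBesovSupVanishing_of_lt`,
  also packaged as the discharged named facts `MemBesovSup.mono_exponent_of_boundedSpace`,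
  `MemBesovSup.memBesovSupVanishing_of_lt_of_boundedSpace`; Hölder ⊂ Besov on a *finite* measure
  space, proved: `MemBoundedHolder.memBesovSup'` (`C^{0,r}_b ⊂ B^r_{p,∞}(μ)`, `0 < r`), the bound
  `MemBoundedHolder.eBesovSupNorm_le` (`‖f‖_{B^r_{p,∞}(μ)} ≤ μ(G)^{1/p} ‖f‖_{C^{0,r}}`) and the
  time-dependent form `MemLpHolder.memLpBesovSup` (`L^q_t C^{0,r}_x ⊂ L^q_t B^r_{p,∞}`), also
  packaged as the discharged named fact `MemBoundedHolder.memBesovSup_of_isFiniteMeasure`; named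
  facts (`def … : Prop`, D-0014) `MemBesovSup.add`, `Torus.IsSmooth.memBesovSup` (discharged in the
  sibling file `BesovDifferenceProofs`), and the three legacy facts of the erratum below.
  **Erratum.** The named facts `MemBesovSup.mono_exponent`,
  `MemBesovSup.memBesovSupVanishing_of_lt` and `MemBoundedHolder.memBesovSup` are *mis-stated*:
  the theorem → `def` demotion dropped the section instances (`[BoundedSpace G]`, respectively
  `[OpensMeasurableSpace G] [SecondCountableTopologyEither G F] [IsFiniteMeasure μ]`; a `def` only
  abstracts the section variables its body mentions), so as closed statements they quantify over
  every normed group `G` / every measure `μ` and are refuted below (`MemBesovSup.not_mono_exponent`,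
  `MemBesovSup.not_memBesovSupVanishing_of_lt`, `MemBoundedHolder.not_memBesovSup`). Read as
  *families* indexed by the implicit `G`, `μ`, … they are true exactly at the intended instances
  (e.g. `MemBesovSup.mono_exponent_holds` in `BesovDifferenceProofs` discharges the first one under
  `[BoundedSpace G]`). As hypotheses prefer the primed theorems (`MemBesovSup.mono_exponent'`,
  `MemBesovSup.memBesovSupVanishing_of_lt'`, `MemBoundedHolder.memBesovSup'`) or the discharged
  corrected facts (`…_of_boundedSpace`, `MemBoundedHolder.memBesovSup_of_isFiniteMeasure`), whose
  statements carry the instances.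

## Design choices

* Generality: `G` a `NormedAddCommGroup` with a `MeasurableSpace` structure and an explicit measure
  `μ` (on the torus `UnitAddTorus d`: `volume`, with the quotient sup norm), `F` a
  `NormedAddCommGroup`; `s : ℝ`, `p : ℝ≥0∞`. Nothing in the definitions needs `0 < s < 1`.
* The classes are *intended* for (right-)translation-invariant `μ` (Haar measure, torus `volume`):
  only then are the translates `f (· + h)` of `f ∈ L^p(μ)` a.e.-strongly measurable, and without
  this `B^s_{p,∞}(μ)` need not be closed under addition (`eLpNorm` of a non-measurable function is
  a lower integral, not subadditive). Accordingly `MemBesovSup.add` assumes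
  `[MeasurableAdd G] [μ.IsAddRightInvariant]`, the Mathlib way (cf. `eLpNorm_add_le'`).
* No division junk: the supremum ranges over `h ≠ 0`, where `ENNReal.ofReal (‖h‖ ^ s) ∈ (0, ∞)`;
  the vanishing condition is a limit along `𝓝[≠] 0`.
* All norms are total and `ℝ≥0∞`-valued (like `eLpNorm`); `eLpBesovSupNorm` is `eLpNorm` in time
  of `t ↦ (eBesovSupNorm s p (u t) μ).toReal` (junk `0` when `u t ∉ B^s_{p,∞}`, no measurability
  in `t`), and the guarded predicates `MemLpBesovSup`/`MemLpBesovSupVanishing` add a.e. membership,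
  exactly as `Literature.Analysis.FunctionSpaces.eLpHolderNorm`/`Literature.Analysis.FunctionSpaces.MemLpHolder`.

## References

* H. Triebel, *Theory of Function Spaces* (1983), §2.5.12 (difference characterisation of
  `B^s_{p,q}`).
* P. Constantin, W. E, E. Titi, *Onsager's conjecture on the energy conservation for solutions of
  Euler's equation*, Comm. Math. Phys. 165 (1994) (`L³_t B^α_{3,∞}`, `α > 1/3`).
* A. Cheskidov, P. Constantin, S. Friedlander, R. Shvydkoy, *Energy conservation and Onsager's
  conjecture for the Euler equations*, Nonlinearity 21 (2008) = arXiv:0704.0759, §2, §3.2 and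
  Thm 3.3 in the arXiv numbering (`B^{1/3}_{3,c(ℕ)} ⊇ B^{1/3}_{3,c₀}`; no "Thm 1.1" exists there).
* A. Cheskidov, X. Luo, *Energy equality for the Navier–Stokes equations in weak-in-time Onsager
  spaces*, Nonlinearity 33 (2020/2021) (`B^s_{p,c₀}`).
-/

open Filter Set MeasureTheory Topology
open scoped NNReal ENNReal

noncomputable section

namespace Literature.Analysis.FunctionSpaces

variable {G : Type*} {F : Type*} [NormedAddCommGroup G] [MeasurableSpace G] [NormedAddCommGroup F]

/-! ## The Besov sup seminorm and the classes `B^s_{p,∞}`, `B^s_{p,c₀}` -/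

section Defs

/-- The `L^p` difference quotient `‖f(· + h) - f‖_{L^p(μ)} / ‖h‖^s` of `f` at the increment `h`
(Triebel 1983, §2.5.12). Meaningful for `h ≠ 0`; at `h = 0` it is `0 / ENNReal.ofReal (0 ^ s)`. [cite: Triebel1983, §2.5.12] -/
def eDiffQuotient (s : ℝ) (p : ℝ≥0∞) (f : G → F) (μ : Measure G) (h : G) : ℝ≥0∞ :=
  eLpNorm (fun x => f (x + h) - f x) p μ / ENNReal.ofReal (‖h‖ ^ s)

/-- The Nikol'skii–Besov seminorm `[f]_{B^s_{p,∞}} = sup_{h ≠ 0} ‖f(· + h) - f‖_{L^p(μ)} / ‖h‖^s`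
(Triebel 1983, §2.5.12; CCFS 2008, §2). The supremum ranges over `h ≠ 0` only. [cite: Triebel1983, §2.5.12] -/
def eBesovSupSeminorm (s : ℝ) (p : ℝ≥0∞) (f : G → F) (μ : Measure G) : ℝ≥0∞ :=
  ⨆ (h : G) (_ : h ≠ 0), eDiffQuotient s p f μ h

/-- The Nikol'skii–Besov norm `‖f‖_{B^s_{p,∞}} = ‖f‖_{L^p} + [f]_{B^s_{p,∞}}`
(Triebel 1983, §2.5.12). [cite: Triebel1983, §2.5.12] -/
def eBesovSupNorm (s : ℝ) (p : ℝ≥0∞) (f : G → F) (μ : Measure G) : ℝ≥0∞ :=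
  eLpNorm f p μ + eBesovSupSeminorm s p f μ

/-- `f ∈ B^s_{p,∞}(μ)`: `f ∈ L^p(μ)` and the Besov sup seminorm is finite
(Triebel 1983, §2.5.12; Constantin–E–Titi 1994). [cite: Triebel1983, §2.5.12] -/
def MemBesovSup (s : ℝ) (p : ℝ≥0∞) (f : G → F) (μ : Measure G) : Prop :=
  MemLp f p μ ∧ eBesovSupSeminorm s p f μ < ∞

/-- `f ∈ B^s_{p,c₀}(μ)` (CCFS 2008, §2; Cheskidov–Luo 2021): `f ∈ B^s_{p,∞}` and the difference
quotient `‖f(· + h) - f‖_{L^p} / ‖h‖^s` tends to `0` as `h → 0`, `h ≠ 0`. [cite: CCFS2008, §2] -/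
def MemBesovSupVanishing (s : ℝ) (p : ℝ≥0∞) (f : G → F) (μ : Measure G) : Prop :=
  MemBesovSup s p f μ ∧ Tendsto (eDiffQuotient s p f μ) (𝓝[≠] 0) (𝓝 0)

variable {s : ℝ} {p : ℝ≥0∞} {f : G → F} {μ : Measure G}

/-- Unfolding lemma for `eDiffQuotient`. [folklore] -/
theorem eDiffQuotient_def (h : G) : eDiffQuotient s p f μ h =
    eLpNorm (fun x => f (x + h) - f x) p μ / ENNReal.ofReal (‖h‖ ^ s) := rfl

/-- Unfolding lemma for `eBesovSupSeminorm` (the outline's formula). [folklore] -/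
theorem eBesovSupSeminorm_def : eBesovSupSeminorm s p f μ =
    ⨆ (h : G) (_ : h ≠ 0), eLpNorm (fun x => f (x + h) - f x) p μ / ENNReal.ofReal (‖h‖ ^ s) :=
  rfl

omit [MeasurableSpace G] [NormedAddCommGroup F] in
/-- The denominator `‖h‖^s` is positive for `h ≠ 0`: no division junk in `eBesovSupSeminorm`. [folklore] -/
theorem ofReal_norm_rpow_pos (s : ℝ) {h : G} (hh : h ≠ 0) : 0 < ENNReal.ofReal (‖h‖ ^ s) :=
  ENNReal.ofReal_pos.2 (Real.rpow_pos_of_pos (norm_pos_iff.2 hh) s)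

/-- Each difference quotient at `h ≠ 0` is bounded by the Besov seminorm. [folklore] -/
theorem eDiffQuotient_le_eBesovSupSeminorm {h : G} (hh : h ≠ 0) :
    eDiffQuotient s p f μ h ≤ eBesovSupSeminorm s p f μ :=
  le_iSup₂ (f := fun (h : G) (_ : h ≠ 0) => eDiffQuotient s p f μ h) h hh

/-- The defining estimate: `‖f(· + h) - f‖_{L^p} ≤ [f]_{B^s_{p,∞}} ‖h‖^s` for `h ≠ 0`. [folklore] -/
theorem eLpNorm_sub_le_eBesovSupSeminorm_mul {h : G} (hh : h ≠ 0) :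
    eLpNorm (fun x => f (x + h) - f x) p μ ≤
      eBesovSupSeminorm s p f μ * ENNReal.ofReal (‖h‖ ^ s) := by
  have := eDiffQuotient_le_eBesovSupSeminorm (s := s) (p := p) (f := f) (μ := μ) hh
  rw [eDiffQuotient_def, ENNReal.div_le_iff (ofReal_norm_rpow_pos s hh).ne' ENNReal.ofReal_ne_top]
    at this
  exact this

/-- `B^s_{p,∞} ⊂ L^p`. [folklore] -/
theorem MemBesovSup.memLp (hf : MemBesovSup s p f μ) : MemLp f p μ := hf.1

/-- The Besov seminorm of `f ∈ B^s_{p,∞}` is finite. [folklore] -/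
theorem MemBesovSup.eBesovSupSeminorm_lt_top (hf : MemBesovSup s p f μ) :
    eBesovSupSeminorm s p f μ < ∞ := hf.2

/-- The Besov norm of `f ∈ B^s_{p,∞}` is finite. [folklore] -/
theorem MemBesovSup.eBesovSupNorm_lt_top (hf : MemBesovSup s p f μ) :
    eBesovSupNorm s p f μ < ∞ :=
  ENNReal.add_lt_top.2 ⟨hf.1.eLpNorm_lt_top, hf.2⟩

/-- For a.e.-strongly measurable `f`, `f ∈ B^s_{p,∞}` iff `‖f‖_{B^s_{p,∞}} < ∞`. [folklore] -/
theorem memBesovSup_iff_eBesovSupNorm_lt_top (hf : AEStronglyMeasurable f μ) :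
    MemBesovSup s p f μ ↔ eBesovSupNorm s p f μ < ∞ := by
  simp only [MemBesovSup, MemLp, hf, true_and, eBesovSupNorm, ENNReal.add_lt_top]

/-- `B^s_{p,c₀} ⊂ B^s_{p,∞}` (CCFS 2008, §2). [cite: CCFS2008, §2] -/
theorem MemBesovSupVanishing.memBesovSup (hf : MemBesovSupVanishing s p f μ) :
    MemBesovSup s p f μ := hf.1

/-- The vanishing condition of `f ∈ B^s_{p,c₀}`. [folklore] -/
theorem MemBesovSupVanishing.tendsto (hf : MemBesovSupVanishing s p f μ) :
    Tendsto (eDiffQuotient s p f μ) (𝓝[≠] 0) (𝓝 0) := hf.2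

/-- `[0]_{B^s_{p,∞}} = 0`. [folklore] -/
@[simp]
theorem eBesovSupSeminorm_zero : eBesovSupSeminorm s p (0 : G → F) μ = 0 := by
  simp [eBesovSupSeminorm, eDiffQuotient]

/-- `0 ∈ B^s_{p,∞}`. [folklore] -/
theorem memBesovSup_zero : MemBesovSup s p (0 : G → F) μ :=
  ⟨MemLp.zero, by simp⟩

/-- `0 ∈ B^s_{p,c₀}`. [folklore] -/
theorem memBesovSupVanishing_zero : MemBesovSupVanishing s p (0 : G → F) μ :=
  ⟨memBesovSup_zero, by
    have : eDiffQuotient s p (0 : G → F) μ = fun _ => 0 := by ext h; simp [eDiffQuotient]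
    rw [this]
    exact tendsto_const_nhds⟩

/-- Translates of an a.e.-strongly measurable function are a.e.-strongly measurable for a
right-invariant measure (via `measurePreserving_add_right`). [folklore] -/
theorem aestronglyMeasurable_comp_add_right [MeasurableAdd G] [μ.IsAddRightInvariant]
    (hf : AEStronglyMeasurable f μ) (h : G) : AEStronglyMeasurable (fun x => f (x + h)) μ :=
  hf.comp_quasiMeasurePreserving (measurePreserving_add_right μ h).quasiMeasurePreserving

/-- `B^s_{p,∞}(μ)` is closed under addition for a right-translation-invariant measure `μ`
(quasi-triangle inequality `eLpNorm_add_le'`, which needs a.e.-strong measurability of the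
translates, supplied by `aestronglyMeasurable_comp_add_right`). Without translation invariance
the statement is false (non-measurable translates; `eLpNorm` is then a lower integral). [cite: TriebelTFS1983, §2.5.12 (B^s_{p,∞} via differences is a quasi-normed linear space)] -/
def MemBesovSup.add : Prop :=
  ∀ [MeasurableAdd G] [μ.IsAddRightInvariant] {g : G → F} (hf : MemBesovSup s p f μ) (hg : MemBesovSup s p g μ),
    MemBesovSup s p (f + g) μ

/-- `B^s_{p,∞}` is closed under negation. [folklore] -/
theorem MemBesovSup.neg (hf : MemBesovSup s p f μ) : MemBesovSup s p (-f) μ := by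
  refine ⟨hf.1.neg, ?_⟩
  convert hf.2 using 1
  simp only [eBesovSupSeminorm, eDiffQuotient, Pi.neg_apply]
  congr! 4 with h _
  rw [← eLpNorm_neg]
  congr 1
  ext x
  simp only [Pi.neg_apply, sub_neg_eq_add]; abel

end Defs

/-! ## Monotonicity in the exponent and the vanishing class -/

section Exponent

variable [BoundedSpace G] {s s' : ℝ} {p : ℝ≥0∞} {f : G → F} {μ : Measure G}

/-- **Mis-stated as a closed statement (the bounded-`G` hypothesis is not in the Lean text): true,
and discharged by `MemBesovSup.mono_exponent_holds` (`BesovDifferenceProofs`), at every bounded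
`G`; false at `G = ℝ`. Prefer `MemBesovSup.mono_exponent'` (proved) or the named fact
`MemBesovSup.mono_exponent_of_boundedSpace` (discharged).** Intended: `B^s_{p,∞} ⊂ B^{s'}_{p,∞}`
for `s' ≤ s` on a *bounded* group `G` (e.g. the torus): `‖h‖^s ≤ (diam G)^{s-s'} ‖h‖^{s'}`
(Triebel 1983, §2.3.2, Prop. 2). As a `def`, however, this `Prop` no longer carries the section
instance `[BoundedSpace G]` (only the variables mentioned in the body are abstracted), so it
asserts the inclusion for *every* normed group `G`, which is false: on unbounded `G` the
homogeneous seminorm is not monotone in `s` (`MemBesovSup.not_mono_exponent`: `G = F = ℝ`,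
`μ = δ₀`, `p = 1`, `f = id`, `s = 1`, `s' = 0`). [cite: Triebel1983, §2.3.2  Prop. 2] -/
def MemBesovSup.mono_exponent : Prop :=
  ∀ (hf : MemBesovSup s p f μ) (hs : s' ≤ s),
    MemBesovSup s' p f μ

/-- **Mis-stated as a closed statement (the bounded-`G` hypothesis is not in the Lean text): true at
every bounded `G` (`MemBesovSup.memBesovSupVanishing_of_lt'`), false at `G = ℝ`. Prefer
`MemBesovSup.memBesovSupVanishing_of_lt'` (proved) or the named fact
`MemBesovSup.memBesovSupVanishing_of_lt_of_boundedSpace` (discharged).** Intended: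
`B^s_{p,∞} ⊂ B^{s'}_{p,c₀}` for `s' < s` on a bounded group `G`: the difference quotient of
order `s'` is `≤ [f]_{B^s_{p,∞}} ‖h‖^{s-s'} → 0` (CCFS 2008, §2; Cheskidov–Luo 2021, §1). As a
`def` this `Prop` lost the section instance `[BoundedSpace G]` and asserts the inclusion for every
normed group `G`, which is false (`MemBesovSup.not_memBesovSupVanishing_of_lt`: `G = F = ℝ`,
`μ = δ₀`, `p = 1`, `f = id`, `s = 1`, `s' = 0`). [cite: CCFS2008, §2] -/
def MemBesovSup.memBesovSupVanishing_of_lt : Prop :=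
  ∀ (hf : MemBesovSup s p f μ) (hs : s' < s),
    MemBesovSupVanishing s' p f μ

end Exponent

/-! ## Hölder functions are Besov -/

section Holder

variable [OpensMeasurableSpace G] [SecondCountableTopologyEither G F]
  {r : ℝ≥0} {f : G → F} {μ : Measure G} [IsFiniteMeasure μ]

/-- **Mis-stated as a closed statement (the finite-measure and measurability instances are not in
the Lean text): true at every finite Borel-compatible `μ` (`MemBoundedHolder.memBesovSup'`), false
for Lebesgue measure on `ℝ`. Prefer `MemBoundedHolder.memBesovSup'` (proved) or the named fact
`MemBoundedHolder.memBesovSup_of_isFiniteMeasure` (discharged).** Intended: `C^{0,r}_b ⊂ B^r_{p,∞}`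
on a finite measure space, `0 < r`: if `‖f(x + h) - f x‖ ≤ C ‖h‖^r` and `f` is bounded then
`‖f(· + h) - f‖_{L^p(μ)} ≤ C μ(G)^{1/p} ‖h‖^r` and `f ∈ L^p(μ)` (CCFS 2008, §1;
Constantin–E–Titi 1994); measurability comes from continuity (`0 < r`). As a `def` this `Prop`
lost the section instances `[OpensMeasurableSpace G] [SecondCountableTopologyEither G F]
[IsFiniteMeasure μ]` and asserts `C^{0,r}_b ⊂ B^r_{p,∞}(μ) ⊂ L^p(μ)` for *every* measure `μ`,
which is false (`MemBoundedHolder.not_memBesovSup`: `f ≡ 1` on `ℝ`, Lebesgue measure, `p = 1`). [cite: CCFS2008, §1] -/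
def MemBoundedHolder.memBesovSup : Prop :=
  ∀ (hf : MemBoundedHolder r f) (hr : 0 < r) (p : ℝ≥0∞),
    MemBesovSup (r : ℝ) p f μ

end Holder

/-! ## Smooth functions on the torus -/

namespace Torus

variable {d : Type*} [Fintype d] [NormedSpace ℝ F] {f : UnitAddTorus d → F}

/-- Smooth functions on the flat torus `𝕋^d` lie in every `B^s_{p,∞}(𝕋^d)`, `s ≤ 1`
(mean value inequality on the periodic lift plus compactness; CCFS 2008, §2). The outline's
lower bound `0 < s` is inessential since the torus is bounded (`MemBesovSup.mono_exponent'`), so it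
is dropped. The norm on `UnitAddTorus d = d → AddCircle 1` is the sup of the quotient norms and
the measure is `volume`. [cite: CCFS2008, §2] -/
def IsSmooth.memBesovSup : Prop :=
  ∀ (hf : IsSmooth f) {s : ℝ} (hs : s ≤ 1) (p : ℝ≥0∞),
    MemBesovSup s p f volume

/-- Smooth functions on the flat torus lie in every `B^s_{p,c₀}(𝕋^d)`, `s < 1` (from
`IsSmooth.memBesovSup` at exponent `1` and `MemBesovSup.memBesovSupVanishing_of_lt'`, see
`IsSmooth.memBesovSupVanishing_of_memBesovSup` below; no lower bound on `s` is needed since the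
torus is bounded). [folklore] -/
def IsSmooth.memBesovSupVanishing : Prop :=
  ∀ (hf : IsSmooth f) {s : ℝ} (hs₁ : s < 1) (p : ℝ≥0∞),
    MemBesovSupVanishing s p f volume

/- interim proof relied on results that are now named facts (D-0014); demoted to a fact by the M5 import, proof preserved:
:=
  (hf.memBesovSup le_rfl p).memBesovSupVanishing_of_lt hs₁
-/

end Torus

/-! ## Time-dependent classes `L^q_t B^s_{p,∞}` and `L^q_t B^s_{p,c₀}` -/

section SpaceTime

variable {s : ℝ} {p q : ℝ≥0∞} {μ : Measure G} {u : ℝ → G → F} {S : Set ℝ}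

/-- The `L^q_t B^s_{p,∞}` norm of `u : ℝ → G → F` on the time set `S`:
`‖ t ↦ ‖u t‖_{B^s_{p,∞}} ‖_{L^q(S)}`, as Mathlib's `eLpNorm` (for `volume.restrict S`) of the real
number `(eBesovSupNorm s p (u t) μ).toReal`. Junk: this is `0` at times where `u t ∉ B^s_{p,∞}`
and `eLpNorm` assumes no measurability in `t`; use the guarded predicates `MemLpBesovSup`,
`MemLpBesovSupVanishing` (Constantin–E–Titi 1994: `L³(0,T; B^α_{3,∞})`). [cite: Titi1994, L³(0 T] -/
def eLpBesovSupNorm (q : ℝ≥0∞) (s : ℝ) (p : ℝ≥0∞) (u : ℝ → G → F) (μ : Measure G) (S : Set ℝ) :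
    ℝ≥0∞ :=
  eLpNorm (fun t => (eBesovSupNorm s p (u t) μ).toReal) q (volume.restrict S)

/-- `u ∈ L^q_t B^s_{p,∞}` on the time set `S` (the *sup* class of Constantin–E–Titi 1994):
`u t ∈ B^s_{p,∞}` for a.e. `t ∈ S` and `‖u‖_{L^q_t B^s_{p,∞}} < ∞`. [cite: Titi1994] -/
def MemLpBesovSup (q : ℝ≥0∞) (s : ℝ) (p : ℝ≥0∞) (u : ℝ → G → F) (μ : Measure G) (S : Set ℝ) :
    Prop :=
  (∀ᵐ t ∂(volume.restrict S), MemBesovSup s p (u t) μ) ∧ eLpBesovSupNorm q s p u μ S < ∞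

/-- `u ∈ L^q_t B^s_{p,c₀}` on the time set `S` (the *vanishing* class of
Cheskidov–Constantin–Friedlander–Shvydkoy 2008, §3.2 and Thm 3.3 (arXiv numbering), and
Cheskidov–Luo 2021):
`u t ∈ B^s_{p,c₀}` for a.e. `t ∈ S` and `‖u‖_{L^q_t B^s_{p,∞}} < ∞`. Strictly smaller than
`MemLpBesovSup`; the two are kept apart on purpose. [cite: CCFS2008, Thm 3.3 (arXiv:0704.0759 numbering)] -/
def MemLpBesovSupVanishing (q : ℝ≥0∞) (s : ℝ) (p : ℝ≥0∞) (u : ℝ → G → F) (μ : Measure G)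
    (S : Set ℝ) : Prop :=
  (∀ᵐ t ∂(volume.restrict S), MemBesovSupVanishing s p (u t) μ) ∧ eLpBesovSupNorm q s p u μ S < ∞

/-- `L^q_t B^s_{p,c₀} ⊂ L^q_t B^s_{p,∞}`. [folklore] -/
theorem MemLpBesovSupVanishing.memLpBesovSup (hu : MemLpBesovSupVanishing q s p u μ S) :
    MemLpBesovSup q s p u μ S :=
  ⟨hu.1.mono fun _ ht => ht.memBesovSup, hu.2⟩

/-- `MemLpBesovSup` unfolds to a.e. membership and finiteness of the norm. [folklore] -/
theorem MemLpBesovSup.eLpBesovSupNorm_lt_top (hu : MemLpBesovSup q s p u μ S) :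
    eLpBesovSupNorm q s p u μ S < ∞ :=
  hu.2

/-- Fields in `L^q_t B^s_{p,∞}` are in `B^s_{p,∞}` at a.e. time of `S`. [folklore] -/
theorem MemLpBesovSup.ae_memBesovSup (hu : MemLpBesovSup q s p u μ S) :
    ∀ᵐ t ∂(volume.restrict S), MemBesovSup s p (u t) μ :=
  hu.1

/-- The zero field is in `L^q_t B^s_{p,∞}`. [folklore] -/
theorem memLpBesovSup_zero : MemLpBesovSup q s p (0 : ℝ → G → F) μ S := by
  refine ⟨Eventually.of_forall fun _ => memBesovSup_zero, ?_⟩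
  simp [eLpBesovSupNorm, eBesovSupNorm]

/-- The zero field is in `L^q_t B^s_{p,c₀}`. [folklore] -/
theorem memLpBesovSupVanishing_zero : MemLpBesovSupVanishing q s p (0 : ℝ → G → F) μ S :=
  ⟨Eventually.of_forall fun _ => memBesovSupVanishing_zero, memLpBesovSup_zero.2⟩

end SpaceTime

/-! ## The exponent facts: corrected statements, proofs, and counterexamples

The named facts `MemBesovSup.mono_exponent` and `MemBesovSup.memBesovSupVanishing_of_lt` above
are **mis-stated**. In the interim library they were (sorried) *theorems* in `section Exponent`
under `variable [BoundedSpace G]`, and a theorem statement includes such an instance variable;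
a `def … : Prop` only keeps the section variables its body mentions, so their demotion to named
facts silently dropped the hypothesis `BoundedSpace G` that both docstrings require (the
signature of `@MemBesovSup.mono_exponent` has no `[BoundedSpace G]` binder). Unguarded, both
are false: see `MemBesovSup.not_mono_exponent` and `MemBesovSup.not_memBesovSupVanishing_of_lt`
below (`G = F = ℝ`, `μ = Measure.dirac 0`, `p = 1`, `f = id`, `s = 1`, `s' = 0`: here
`‖f(· + h) - f‖_{L¹(δ₀)} = |h|`, so `[f]_{B¹_{1,∞}(δ₀)} ≤ 1` while `[f]_{B⁰_{1,∞}(δ₀)} = sup_h |h| = ∞`).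
The corrected facts `MemBesovSup.mono_exponent_of_boundedSpace` and
`MemBesovSup.memBesovSupVanishing_of_lt_of_boundedSpace` restore the hypothesis (as a leading
binder `∀ [BoundedSpace G]`, the way `MemBesovSup.add` carries its instance hypotheses) and are
proved (`…_holds`) through the dot-notation forms `MemBesovSup.mono_exponent'` and
`MemBesovSup.memBesovSupVanishing_of_lt'`. The proofs are elementary: for `h ≠ 0`,
`‖h‖^{-s'} = ‖h‖^{s-s'} · ‖h‖^{-s}`, and on a bounded `G` (`‖h‖ ≤ R`) the factor `‖h‖^{s-s'}` is
`≤ R^{s-s'}` for `s' ≤ s` and tends to `0` as `h → 0` for `s' < s`. In the sources the spaces are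
the Littlewood–Paley ones on `ℝⁿ`: `B^{s+ε}_{p,q₀} ⊂ B^s_{p,q₁}` is Triebel 1983, §2.3.2,
Prop. 2(ii), eq. (7), and the vanishing class `B^{1/3}_{3,c(ℕ)}` (`lim_q λ_q^{1/3} ‖Δ_q u‖₃ = 0`,
with `B^{1/3}_{3,p} ⊂ B^{1/3}_{3,c(ℕ)}` for `p < ∞`) is Cheskidov–Constantin–Friedlander–Shvydkoy
2008, §3.2; the statements here are their difference-quotient counterparts on a bounded group. -/

section ExponentProofs

variable {s s' : ℝ} {p : ℝ≥0∞} {f : G → F} {μ : Measure G}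

/-- Lowering the exponent costs a factor `‖h‖^{s-s'}`:
`‖f(· + h) - f‖_{L^p} / ‖h‖^{s'} ≤ [f]_{B^s_{p,∞}} · ‖h‖^{s-s'}` for `h ≠ 0` (any real `s, s'`),
since `‖h‖^{s-s'} ‖h‖^{s'} = ‖h‖^s`. [folklore] -/
theorem eDiffQuotient_le_eBesovSupSeminorm_mul_rpow {h : G} (hh : h ≠ 0) :
    eDiffQuotient s' p f μ h ≤ eBesovSupSeminorm s p f μ * ENNReal.ofReal (‖h‖ ^ (s - s')) := by
  rw [eDiffQuotient_def,
    ENNReal.div_le_iff (ofReal_norm_rpow_pos s' hh).ne' ENNReal.ofReal_ne_top, mul_assoc,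
    ← ENNReal.ofReal_mul (Real.rpow_nonneg (norm_nonneg _) _), ← Real.rpow_add (norm_pos_iff.2 hh),
    sub_add_cancel]
  exact eLpNorm_sub_le_eBesovSupSeminorm_mul hh

/-- If `‖h‖ ≤ R` for all `h : G` and `s' ≤ s`, then `[f]_{B^{s'}_{p,∞}} ≤ [f]_{B^s_{p,∞}} · R^{s-s'}`.
[folklore] -/
theorem eBesovSupSeminorm_le_mul_rpow_of_norm_le (hs : s' ≤ s) {R : ℝ} (hR : ∀ h : G, ‖h‖ ≤ R) :
    eBesovSupSeminorm s' p f μ ≤ eBesovSupSeminorm s p f μ * ENNReal.ofReal (R ^ (s - s')) :=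
  iSup₂_le fun h hh => (eDiffQuotient_le_eBesovSupSeminorm_mul_rpow hh).trans <|
    mul_le_mul_right (ENNReal.ofReal_le_ofReal <|
      Real.rpow_le_rpow (norm_nonneg _) (hR h) (sub_nonneg.2 hs)) _

omit [MeasurableSpace G] in
/-- For `s' < s` the factor `‖h‖^{s-s'}` tends to `0` as `h → 0`, `h ≠ 0` (in `ℝ≥0∞`). [folklore] -/
theorem tendsto_ofReal_norm_rpow_sub (hs : s' < s) :
    Tendsto (fun h : G => ENNReal.ofReal (‖h‖ ^ (s - s'))) (𝓝[≠] 0) (𝓝 0) := by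
  have h1 : Tendsto (fun h : G => ‖h‖ ^ (s - s')) (𝓝 0) (𝓝 0) := by
    have := ((Real.continuous_rpow_const (sub_pos.2 hs).le).tendsto ‖(0 : G)‖).comp
      (continuous_norm.tendsto (0 : G))
    simpa [Function.comp_def, Real.zero_rpow (sub_pos.2 hs).ne'] using this
  simpa using (ENNReal.tendsto_ofReal h1).mono_left nhdsWithin_le_nhds

/-- `B^s_{p,∞} ⊂ B^{s'}_{p,∞}` for `s' ≤ s` on a *bounded* group `G` (e.g. the torus): with `R`
a bound for the norm on `G`, `[f]_{B^{s'}_{p,∞}} ≤ [f]_{B^s_{p,∞}} · R^{s-s'} < ∞`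
(`eBesovSupSeminorm_le_mul_rpow_of_norm_le`). This is the difference-quotient counterpart of
the elementary embedding `B^{s+ε}_{p,q₀}(ℝⁿ) ⊂ B^s_{p,q₁}(ℝⁿ)` of Triebel 1983, §2.3.2,
Prop. 2(ii), eq. (7); on an unbounded `G` the homogeneous seminorm is not monotone in `s`
(`MemBesovSup.not_mono_exponent`). [cite: TriebelTFS1983, §2.3.2 Prop. 2(ii) eq. (7)] -/
theorem MemBesovSup.mono_exponent' [BoundedSpace G] (hf : MemBesovSup s p f μ) (hs : s' ≤ s) :
    MemBesovSup s' p f μ := by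
  obtain ⟨R, hR⟩ := (Bornology.IsBounded.all (Set.univ : Set G)).exists_norm_le
  exact ⟨hf.1, (eBesovSupSeminorm_le_mul_rpow_of_norm_le hs fun h => hR h (Set.mem_univ h)).trans_lt
    (ENNReal.mul_lt_top hf.2 ENNReal.ofReal_lt_top)⟩

/-- `B^s_{p,∞} ⊂ B^{s'}_{p,c₀}` for `s' < s` on a *bounded* group `G`: membership in `B^{s'}_{p,∞}`
is `MemBesovSup.mono_exponent'`, and the difference quotient of order `s'` is squeezed by
`0 ≤ ‖f(· + h) - f‖_{L^p} / ‖h‖^{s'} ≤ [f]_{B^s_{p,∞}} · ‖h‖^{s-s'} → 0` as `h → 0`, `h ≠ 0`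
(`[f]_{B^s_{p,∞}} < ∞`). Difference-quotient counterpart of `B^{1/3}_{3,p} ⊂ B^{1/3}_{3,c(ℕ)}`,
`p < ∞` (Cheskidov–Constantin–Friedlander–Shvydkoy 2008, §3.2, right after the definition of
`B^{1/3}_{3,c(ℕ)}`) combined with `B^{s}_{3,∞} ⊂ B^{1/3}_{3,p}` for `s > 1/3` (Triebel 1983,
§2.3.2, Prop. 2(ii)). [cite: CCFS2008, §3.2] -/
theorem MemBesovSup.memBesovSupVanishing_of_lt' [BoundedSpace G] (hf : MemBesovSup s p f μ)
    (hs : s' < s) : MemBesovSupVanishing s' p f μ := by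
  refine ⟨hf.mono_exponent' hs.le, ?_⟩
  have h0 : Tendsto (fun h : G => eBesovSupSeminorm s p f μ * ENNReal.ofReal (‖h‖ ^ (s - s')))
      (𝓝[≠] 0) (𝓝 0) := by
    simpa using ENNReal.Tendsto.const_mul (tendsto_ofReal_norm_rpow_sub hs) (Or.inr hf.2.ne)
  exact tendsto_of_tendsto_of_tendsto_of_le_of_le' tendsto_const_nhds h0
    (Eventually.of_forall fun _ => zero_le)
    (eventually_nhdsWithin_of_forall fun h hh =>
      eDiffQuotient_le_eBesovSupSeminorm_mul_rpow (Set.mem_compl_singleton_iff.mp hh))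

/-- Corrected form of the named fact `MemBesovSup.mono_exponent` (whose Lean statement lost the
hypothesis `BoundedSpace G` of its docstring, see the section header): `B^s_{p,∞} ⊂ B^{s'}_{p,∞}`
for `s' ≤ s` **on a bounded group `G`**. Proved: `MemBesovSup.mono_exponent_of_boundedSpace_holds`.
[cite: TriebelTFS1983, §2.3.2 Prop. 2(ii) eq. (7)] -/
def MemBesovSup.mono_exponent_of_boundedSpace : Prop :=
  ∀ [BoundedSpace G], MemBesovSup s p f μ → s' ≤ s → MemBesovSup s' p f μ

/-- Corrected form of the named fact `MemBesovSup.memBesovSupVanishing_of_lt` (whose Lean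
statement lost the hypothesis `BoundedSpace G` of its docstring, see the section header):
`B^s_{p,∞} ⊂ B^{s'}_{p,c₀}` for `s' < s` **on a bounded group `G`**. Proved:
`MemBesovSup.memBesovSupVanishing_of_lt_of_boundedSpace_holds`. [cite: CCFS2008, §3.2] -/
def MemBesovSup.memBesovSupVanishing_of_lt_of_boundedSpace : Prop :=
  ∀ [BoundedSpace G], MemBesovSup s p f μ → s' < s → MemBesovSupVanishing s' p f μ

/-- Discharge of `MemBesovSup.mono_exponent_of_boundedSpace`. [folklore] -/
theorem MemBesovSup.mono_exponent_of_boundedSpace_holds :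
    MemBesovSup.mono_exponent_of_boundedSpace (s := s) (s' := s') (p := p) (f := f) (μ := μ) := by
  intro _ hf hs
  exact hf.mono_exponent' hs

/-- Discharge of `MemBesovSup.memBesovSupVanishing_of_lt_of_boundedSpace`. [folklore] -/
theorem MemBesovSup.memBesovSupVanishing_of_lt_of_boundedSpace_holds :
    MemBesovSup.memBesovSupVanishing_of_lt_of_boundedSpace
      (s := s) (s' := s') (p := p) (f := f) (μ := μ) := by
  intro _ hf hs
  exact hf.memBesovSupVanishing_of_lt' hs

/-! ### Counterexamples to the unguarded facts

On `G = F = ℝ` with the Dirac measure `δ₀`, `p = 1` and `f = id`, the translate difference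
`f(· + h) - f` is the constant `h`, so `‖f(· + h) - f‖_{L¹(δ₀)} / |h|^s = |h|^{1-s}`. -/

/-- For `f = id` on `ℝ` and `μ = δ₀`: `‖f(· + h) - f‖_{L¹(δ₀)} / |h|^s = ‖h‖ₑ / |h|^s`. [folklore] -/
theorem eDiffQuotient_id_dirac (s h : ℝ) :
    eDiffQuotient s 1 (fun x : ℝ => x) (Measure.dirac 0) h = ‖h‖ₑ / ENNReal.ofReal (|h| ^ s) := by
  simp [eDiffQuotient, eLpNorm_one_eq_lintegral_enorm]

/-- `id ∈ B¹_{1,∞}(ℝ, δ₀)`: `‖id‖_{L¹(δ₀)} = 0` and every difference quotient of order `1` equals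
`‖h‖ₑ / |h| ≤ 1`. [folklore] -/
theorem memBesovSup_one_id_dirac : MemBesovSup 1 1 (fun x : ℝ => x) (Measure.dirac 0) := by
  refine ⟨⟨measurable_id.aestronglyMeasurable, ?_⟩, ?_⟩
  · rw [eLpNorm_one_eq_lintegral_enorm, lintegral_dirac]
    simp
  · refine lt_of_le_of_lt (iSup₂_le fun h _ => ?_) ENNReal.one_lt_top
    rw [eDiffQuotient_id_dirac, Real.rpow_one, ← Real.enorm_eq_ofReal_abs]
    exact ENNReal.div_self_le_one

/-- `[id]_{B⁰_{1,∞}(ℝ, δ₀)} = ∞`: the difference quotient of order `0` at `h = n` is `n`. [folklore] -/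
theorem eBesovSupSeminorm_zero_id_dirac :
    eBesovSupSeminorm 0 1 (fun x : ℝ => x) (Measure.dirac 0) = ∞ := by
  refine eq_top_iff.2 ?_
  rw [← ENNReal.iSup_natCast]
  refine iSup_le fun n => ?_
  rcases Nat.eq_zero_or_pos n with rfl | hn
  · simp
  · calc (n : ℝ≥0∞) = eDiffQuotient 0 1 (fun x : ℝ => x) (Measure.dirac 0) n := by
          rw [eDiffQuotient_id_dirac, Real.rpow_zero, ENNReal.ofReal_one, div_one, Real.enorm_natCast]
      _ ≤ _ := eDiffQuotient_le_eBesovSupSeminorm (Nat.cast_ne_zero.2 hn.ne')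

/-- The unguarded named fact `MemBesovSup.mono_exponent` is **false**: at `G = F = ℝ`,
`μ = δ₀`, `p = 1`, `f = id`, `s = 1`, `s' = 0` it would put `id ∈ B¹_{1,∞}(δ₀)` into
`B⁰_{1,∞}(δ₀)`, whose seminorm is `∞` (`eBesovSupSeminorm_zero_id_dirac`). [folklore] -/
theorem MemBesovSup.not_mono_exponent :
    ¬ MemBesovSup.mono_exponent (s := 1) (s' := 0) (p := 1) (f := fun x : ℝ => x)
      (μ := Measure.dirac 0) := by
  intro h
  have := (h memBesovSup_one_id_dirac zero_le_one).2
  rw [eBesovSupSeminorm_zero_id_dirac] at this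
  exact lt_irrefl _ this

/-- The unguarded named fact `MemBesovSup.memBesovSupVanishing_of_lt` is **false** (same
counterexample as `MemBesovSup.not_mono_exponent`, with `s' = 0 < 1 = s`). [folklore] -/
theorem MemBesovSup.not_memBesovSupVanishing_of_lt :
    ¬ MemBesovSup.memBesovSupVanishing_of_lt (s := 1) (s' := 0) (p := 1) (f := fun x : ℝ => x)
      (μ := Measure.dirac 0) := by
  intro h
  have := (h memBesovSup_one_id_dirac zero_lt_one).1.2
  rw [eBesovSupSeminorm_zero_id_dirac] at this
  exact lt_irrefl _ this

end ExponentProofs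

/-! ### Lowering the exponent in the time-dependent classes -/

section SpaceTimeExponent

variable {s s' : ℝ} {p q : ℝ≥0∞} {μ : Measure G} {u : ℝ → G → F} {S : Set ℝ}

/-- If `‖h‖ ≤ R` on `G` and `s' ≤ s`, then `‖f‖_{B^{s'}_{p,∞}} ≤ max 1 R^{s-s'} · ‖f‖_{B^s_{p,∞}}`
(`eBesovSupSeminorm_le_mul_rpow_of_norm_le` plus `‖f‖_{L^p} ≤ max 1 R^{s-s'} · ‖f‖_{L^p}`).
[folklore] -/
theorem eBesovSupNorm_le_mul_of_norm_le (hs : s' ≤ s) {R : ℝ} (hR : ∀ h : G, ‖h‖ ≤ R)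
    {f : G → F} :
    eBesovSupNorm s' p f μ ≤ ENNReal.ofReal (max 1 (R ^ (s - s'))) * eBesovSupNorm s p f μ := by
  rw [eBesovSupNorm, eBesovSupNorm, mul_add]
  gcongr
  · exact le_mul_of_one_le_left zero_le (ENNReal.one_le_ofReal.2 (le_max_left _ _))
  · calc eBesovSupSeminorm s' p f μ
        ≤ eBesovSupSeminorm s p f μ * ENNReal.ofReal (R ^ (s - s')) :=
          eBesovSupSeminorm_le_mul_rpow_of_norm_le hs hR
      _ ≤ ENNReal.ofReal (max 1 (R ^ (s - s'))) * eBesovSupSeminorm s p f μ := by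
          rw [mul_comm]
          gcongr
          exact le_max_right _ _

/-- `L^q_t B^s_{p,∞} ⊂ L^q_t B^{s'}_{p,∞}` for `s' ≤ s` on a *bounded* group `G`: slice-wise
`MemBesovSup.mono_exponent'`, and `‖u t‖_{B^{s'}_{p,∞}} ≤ max 1 R^{s-s'} · ‖u t‖_{B^s_{p,∞}}` at
a.e. time (`eBesovSupNorm_le_mul_of_norm_le`; both norms are finite there, so the real-valued
integrands compare) gives `‖u‖_{L^q_t B^{s'}_{p,∞}} ≤ max 1 R^{s-s'} · ‖u‖_{L^q_t B^s_{p,∞}} < ∞`.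
[folklore] -/
theorem MemLpBesovSup.mono_exponent [BoundedSpace G] (hu : MemLpBesovSup q s p u μ S)
    (hs : s' ≤ s) : MemLpBesovSup q s' p u μ S := by
  obtain ⟨R, hR⟩ := (Bornology.IsBounded.all (Set.univ : Set G)).exists_norm_le
  have hR' : ∀ h : G, ‖h‖ ≤ R := fun h => hR h (Set.mem_univ h)
  refine ⟨hu.1.mono fun t ht => ht.mono_exponent' hs, ?_⟩
  have hae : ∀ᵐ t ∂(volume.restrict S), ‖(eBesovSupNorm s' p (u t) μ).toReal‖ ≤
      max 1 (R ^ (s - s')) * ‖(eBesovSupNorm s p (u t) μ).toReal‖ := by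
    filter_upwards [hu.1] with t ht
    rw [Real.norm_of_nonneg ENNReal.toReal_nonneg, Real.norm_of_nonneg ENNReal.toReal_nonneg,
      ← ENNReal.toReal_ofReal (zero_le_one.trans (le_max_left 1 (R ^ (s - s')))),
      ← ENNReal.toReal_mul]
    exact ENNReal.toReal_mono (ENNReal.mul_ne_top ENNReal.ofReal_ne_top ht.eBesovSupNorm_lt_top.ne)
      (eBesovSupNorm_le_mul_of_norm_le hs hR')
  exact (eLpNorm_le_mul_eLpNorm_of_ae_le_mul hae q).trans_lt
    (ENNReal.mul_lt_top ENNReal.ofReal_lt_top hu.2)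

/-- `L^q_t B^s_{p,∞} ⊂ L^q_t B^{s'}_{p,c₀}` for `s' < s` on a *bounded* group `G`: slice-wise
`MemBesovSup.memBesovSupVanishing_of_lt'` plus `MemLpBesovSup.mono_exponent` for the norm. This
is the abstract form of "`L³_t B^α_{3,∞} ⊂ L³_t B^{1/3}_{3,c₀}` for `α > 1/3`", by which CCFS 2008
(Thm 3.3 and §3.2, arXiv numbering) recover Constantin–E–Titi 1994. [cite: CCFS2008, §3.2] -/
theorem MemLpBesovSup.memLpBesovSupVanishing_of_lt [BoundedSpace G]
    (hu : MemLpBesovSup q s p u μ S) (hs : s' < s) : MemLpBesovSupVanishing q s' p u μ S :=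
  ⟨hu.1.mono fun _ ht => ht.memBesovSupVanishing_of_lt' hs, (hu.mono_exponent hs.le).2⟩

end SpaceTimeExponent

/-! ### The torus corollary, threaded to the corrected fact -/

namespace Torus

variable {d : Type*} [Fintype d] [NormedSpace ℝ F] {f : UnitAddTorus d → F}

/-- `IsSmooth.memBesovSupVanishing` follows from `IsSmooth.memBesovSup` (at exponent `1`) and the
*corrected* exponent fact, i.e. `MemBesovSup.memBesovSupVanishing_of_lt'` on the bounded (compact)
torus — the interim proof, restored. [folklore] -/
theorem IsSmooth.memBesovSupVanishing_of_memBesovSup (h : IsSmooth.memBesovSup (f := f)) :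
    IsSmooth.memBesovSupVanishing (f := f) := by
  intro hf s hs₁ p
  exact (h hf le_rfl p).memBesovSupVanishing_of_lt' hs₁

end Torus

/-! ## Hölder functions are Besov: corrected statement, proof, and counterexample

`#check @MemBoundedHolder.memBesovSup` shows the named fact without the instances
`[OpensMeasurableSpace G] [SecondCountableTopologyEither G F] [IsFiniteMeasure μ]` of its section
(same demotion artefact as in `section Exponent`), so it claims `C^{0,r}_b ⊂ B^r_{p,∞}(μ)` for every
measure `μ`; `MemBoundedHolder.not_memBesovSup` refutes this, `MemBoundedHolder.memBesovSup'`
proves the intended statement, and `MemBoundedHolder.memBesovSup_of_isFiniteMeasure` (+ `_holds`)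
is the corrected named fact. -/

section HolderProofs

variable {r : ℝ≥0} {f : G → F} {μ : Measure G}

/-- An `r`-Hölder map with constant `D` has `L^p(μ)` difference quotient of order `r` at most
`μ(G)^{1/p} · D` at every `h ≠ 0`: `‖f(x + h) - f x‖ ≤ D ‖h‖^r` pointwise and
`eLpNorm_le_of_ae_bound`. [folklore] -/
theorem _root_.HolderWith.eDiffQuotient_le {D : ℝ≥0} (hD : HolderWith D r f) {p : ℝ≥0∞} {h : G}
    (hh : h ≠ 0) : eDiffQuotient (r : ℝ) p f μ h ≤ μ Set.univ ^ p.toReal⁻¹ * ENNReal.ofReal D := by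
  rw [eDiffQuotient_def,
    ENNReal.div_le_iff (ofReal_norm_rpow_pos _ hh).ne' ENNReal.ofReal_ne_top]
  have hb : ∀ᵐ x ∂μ, ‖f (x + h) - f x‖ ≤ D * ‖h‖ ^ (r : ℝ) := Eventually.of_forall fun x => by
    have := hD.dist_le (x + h) x
    rwa [dist_eq_norm, dist_eq_norm, add_sub_cancel_left] at this
  calc eLpNorm (fun x => f (x + h) - f x) p μ
      ≤ μ Set.univ ^ p.toReal⁻¹ * ENNReal.ofReal (D * ‖h‖ ^ (r : ℝ)) := eLpNorm_le_of_ae_bound hb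
    _ = μ Set.univ ^ p.toReal⁻¹ * ENNReal.ofReal D * ENNReal.ofReal (‖h‖ ^ (r : ℝ)) := by
      rw [ENNReal.ofReal_mul D.coe_nonneg, mul_assoc]

/-- `C^{0,r}_b ⊂ B^r_{p,∞}(μ)` for `0 < r` on a *finite* measure space whose σ-algebra contains
the open sets (the intended content of the named fact `MemBoundedHolder.memBesovSup`): `f` is
continuous (`0 < r`) hence a.e.-strongly measurable, bounded hence in `L^p(μ)`
(`MemLp.of_bound`), and `‖f(· + h) - f‖_{L^p(μ)} ≤ μ(G)^{1/p} [f]_r ‖h‖^r`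
(`HolderWith.eDiffQuotient_le`), so `[f]_{B^r_{p,∞}} ≤ μ(G)^{1/p} [f]_r < ∞`. This is the
embedding `C^α ⊂ B^α_{3,∞}` behind "Constantin, E and Titi proved energy conservation for `u` in
the Besov space `B^α_{3,∞}`, `α > 1/3`" as the answer to Onsager's Hölder-`C^α` conjecture
(CCFS 2008, §1, p. 3). [cite: CCFS2008, §1] -/
theorem MemBoundedHolder.memBesovSup' [OpensMeasurableSpace G] [SecondCountableTopologyEither G F]
    [IsFiniteMeasure μ] (hf : MemBoundedHolder r f) (hr : 0 < r) (p : ℝ≥0∞) :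
    MemBesovSup (r : ℝ) p f μ := by
  obtain ⟨⟨C, hC⟩, ⟨D, hD⟩⟩ := memBoundedHolder_iff.1 hf
  refine ⟨MemLp.of_bound (hf.continuous hr).aestronglyMeasurable C (Eventually.of_forall hC), ?_⟩
  refine lt_of_le_of_lt (iSup₂_le fun h hh => hD.eDiffQuotient_le hh) ?_
  exact ENNReal.mul_lt_top
    (ENNReal.rpow_lt_top_of_nonneg (inv_nonneg.2 ENNReal.toReal_nonneg) (measure_ne_top _ _))
    ENNReal.ofReal_lt_top

/-- Corrected form of the named fact `MemBoundedHolder.memBesovSup` (whose Lean statement lost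
the section instances `[OpensMeasurableSpace G] [SecondCountableTopologyEither G F]
[IsFiniteMeasure μ]`, see above): `C^{0,r}_b ⊂ B^r_{p,∞}(μ)` for `0 < r` **on a finite measure
space** (Borel-compatible σ-algebra). Proved: `MemBoundedHolder.memBesovSup_of_isFiniteMeasure_holds`.
[cite: CCFS2008, §1] -/
def MemBoundedHolder.memBesovSup_of_isFiniteMeasure : Prop :=
  ∀ [OpensMeasurableSpace G] [SecondCountableTopologyEither G F] [IsFiniteMeasure μ],
    MemBoundedHolder r f → 0 < r → ∀ p : ℝ≥0∞, MemBesovSup (r : ℝ) p f μ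

/-- Discharge of `MemBoundedHolder.memBesovSup_of_isFiniteMeasure`. [folklore] -/
theorem MemBoundedHolder.memBesovSup_of_isFiniteMeasure_holds :
    MemBoundedHolder.memBesovSup_of_isFiniteMeasure (r := r) (f := f) (μ := μ) := by
  intro _ _ _ hf hr p
  exact hf.memBesovSup' hr p

/-- Quantitative form of `MemBoundedHolder.memBesovSup'`: for `f ∈ C^{0,r}_b`,
`‖f‖_{B^r_{p,∞}(μ)} ≤ μ(G)^{1/p} · ‖f‖_{C^{0,r}}` (`‖f‖_{L^p(μ)} ≤ μ(G)^{1/p} ‖f‖_∞` and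
`[f]_{B^r_{p,∞}(μ)} ≤ μ(G)^{1/p} [f]_r`). No finiteness of `μ` or measurability is needed for
the inequality itself. [folklore] -/
theorem MemBoundedHolder.eBesovSupNorm_le (hf : MemBoundedHolder r f) (p : ℝ≥0∞) :
    eBesovSupNorm (r : ℝ) p f μ ≤ μ Set.univ ^ p.toReal⁻¹ * eBoundedHolderNorm r f := by
  rw [eBesovSupNorm, eBoundedHolderNorm_def, mul_add]
  refine add_le_add ?_ ?_
  · have hb : ∀ᵐ x ∂μ, ‖f x‖ₑ ≤ eSupNorm f := Eventually.of_forall fun x => enorm_le_eSupNorm f x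
    simpa [mul_comm] using eLpNorm_le_of_ae_enorm_bound (p := p) hb
  · have hD := hf.memHolder.holderWith
    refine le_trans (iSup₂_le fun h hh => hD.eDiffQuotient_le hh) (le_of_eq ?_)
    rw [ENNReal.ofReal_coe_nnreal, hf.memHolder.coe_nnHolderNorm_eq_eHolderNorm]

variable {q : ℝ≥0∞} {u : ℝ → G → F} {S : Set ℝ}

/-- `L^q_t C^{0,r}_x ⊂ L^q_t B^r_{p,∞}` on a finite measure space, `0 < r`: slice-wise
`MemBoundedHolder.memBesovSup'` at a.e. time, and
`‖u t‖_{B^r_{p,∞}(μ)} ≤ μ(G)^{1/p} ‖u t‖_{C^{0,r}}` (`MemBoundedHolder.eBesovSupNorm_le`; both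
sides finite there, so the real-valued integrands compare) gives
`‖u‖_{L^q_t B^r_{p,∞}} ≤ μ(G)^{1/p} ‖u‖_{L^q_t C^{0,r}_x} < ∞`. This is the passage from the
Hölder classes `L³_t C^α_x ⊃ C⁰_t C^α_x` of Onsager's conjecture to the Besov class
`L³_t B^α_{3,∞}` of Constantin–E–Titi (CCFS 2008, §1, p. 3). [cite: CCFS2008, §1] -/
theorem MemLpHolder.memLpBesovSup [OpensMeasurableSpace G] [SecondCountableTopologyEither G F]
    [IsFiniteMeasure μ] (hu : MemLpHolder q r u S) (hr : 0 < r) (p : ℝ≥0∞) :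
    MemLpBesovSup q (r : ℝ) p u μ S := by
  refine ⟨hu.1.mono fun t ht => ht.memBesovSup' hr p, ?_⟩
  have hc : μ Set.univ ^ p.toReal⁻¹ ≠ ∞ :=
    (ENNReal.rpow_lt_top_of_nonneg (inv_nonneg.2 ENNReal.toReal_nonneg) (measure_ne_top _ _)).ne
  have hae : ∀ᵐ t ∂(volume.restrict S), ‖(eBesovSupNorm (r : ℝ) p (u t) μ).toReal‖ ≤
      (μ Set.univ ^ p.toReal⁻¹).toReal * ‖boundedHolderNorm r (u t)‖ := by
    filter_upwards [hu.1] with t ht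
    rw [boundedHolderNorm, Real.norm_of_nonneg ENNReal.toReal_nonneg,
      Real.norm_of_nonneg ENNReal.toReal_nonneg, ← ENNReal.toReal_mul]
    exact ENNReal.toReal_mono (ENNReal.mul_ne_top hc ht.eBoundedHolderNorm_lt_top.ne)
      (ht.eBesovSupNorm_le p)
  exact (eLpNorm_le_mul_eLpNorm_of_ae_le_mul hae q).trans_lt
    (ENNReal.mul_lt_top ENNReal.ofReal_lt_top hu.2)

/-- The constant function `1 : ℝ → ℝ` is in `C^{0,1}_b`. [folklore] -/
theorem memBoundedHolder_const_one : MemBoundedHolder 1 (fun _ : ℝ => (1 : ℝ)) :=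
  memBoundedHolder_iff.2 ⟨⟨1, fun _ => by simp⟩, ⟨0, fun x y => by simp⟩⟩

/-- The named fact `MemBoundedHolder.memBesovSup` is false as stated: it claims
`C^{0,r}_b ⊂ B^r_{p,∞}(μ) ⊂ L^p(μ)` for *every* measure `μ`, but the constant `1` is in
`C^{0,1}_b(ℝ)` and not in `L¹(ℝ, dx)` (`memLp_const_iff`, `volume univ = ∞`). [folklore] -/
theorem MemBoundedHolder.not_memBesovSup :
    ¬ MemBoundedHolder.memBesovSup (G := ℝ) (F := ℝ) (r := 1) (f := fun _ => (1 : ℝ))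
      (μ := volume) := by
  intro h
  have h1 : MemLp (fun _ : ℝ => (1 : ℝ)) 1 (volume : Measure ℝ) :=
    (h memBoundedHolder_const_one one_pos 1).memLp
  rcases (memLp_const_iff one_ne_zero ENNReal.one_ne_top).1 h1 with h0 | hμ
  · exact one_ne_zero h0
  · simp at hμ

end HolderProofs

end Literature.Analysis.FunctionSpaces
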